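import Summits.QuantumAdvantage.QuantumAdvantage.Theorems.CharDialTokenDialJ1
import HarnessLib

/-!
# CharDial tower — the TOKEN DIAL, part J: the FLIP ENGINE INEQUALITY (reacting near readers; §12b)

Cell `decomp-qadv`, lens 6 («barrier-complement carving»), generation 19 (REV3); supports stmt-QuantumAdvantage-27206 / 27207
(crux 32604).  Imports part J1 (`flip_iff_phi`).

★ `engineFlip`: for a junta ⊕ `𝔽_p`-form presentation (`3 ∤ p`), an adjacent pair `(s, t = s+1)`, a half-width `w` and ANY set
`G' ∋ cut t` of cuts, each within distance `w` of cut `t`, outside which the strategy is swap-stable on `{u : u_s ≠ u_t}`: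
`6·#WIN_c + #flipAny ≤ 6·2ⁿ + 8·p^{|G'|}·2^{Σ_{g∈G'}|J_g| + 2w}·(2cos(π/(3p)))ⁿ`,
where `flipAny y s t = {u : u_s ≠ u_t, win_c(u^{(st)}) ≠ win_c(u) for some c ∈ {0,1,2}}` is a property of the STRATEGY.
Unlike dials 6–8 the readers may REACT to the transposition (their decisions may move); what is paid for is only their number
and their distance to the pair.  Proof: the swap set is tiled by the multi-form cells `(T ⊆ O, V)` of part D2 over
`O = {s,t} ∪ juntas(G') ∪ window`; by part J1 the flip of `win_c` on a cell is the charge-free table `phi (T,V) (addr_c(u,t))`;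
`flipAny` lies in the union of the cells whose table has a flipping class `r₀`; on such a cell the class-`r₀` part flips at charge
`c` (so lies in `flipE_c`) and is a third of the cell up to `2·(2cos(π/3p))ⁿ` (`cell_le_three_addrM`, [CW2009, Lemma 5]); the
pairing inequality `2·#WIN_c + |flipE_c| ≤ 2·2ⁿ` (part D1) finishes.  0 sorry.  Part K turns it into the ninth dial `flip_hard K w`.
-/

set_option autoImplicit false

namespace Summit.QuantumAdvantage.AdviceFreeQNC0.JLinPeel.TokenDial

open Finset SegMove

variable {n : ℕ}

section FlipEngine

variable {p : ℕ} [hp : Fact p.Prime]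

/-! ### §12b the any-charge flip set, all cells, flipping cells -/

/-- **the ANY-CHARGE FLIP SET** of the pair `(s, t)`: swap-set inputs at which the transposition flips the win bit for SOME charge
`c ∈ {0, 1, 2}` (a property of the strategy `y` alone). -/
def flipAny (y : Fin (n + 1) → (Fin n → Bool) → Bool) (s t : Fin n) : Finset (Fin n → Bool) :=
  univ.filter fun u => u s ≠ u t ∧ (ringWinU 0 y (segCompl u s.val (s.val + 2)) ≠ ringWinU 0 y u ∨
    ringWinU 1 y (segCompl u s.val (s.val + 2)) ≠ ringWinU 1 y u ∨ ringWinU 2 y (segCompl u s.val (s.val + 2)) ≠ ringWinU 2 y u)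

omit hp in
/-- membership in `flipAny`. -/
theorem mem_flipAny (y : Fin (n + 1) → (Fin n → Bool) → Bool) (s t : Fin n) (u : Fin n → Bool) :
    u ∈ flipAny y s t ↔ u s ≠ u t ∧ (ringWinU 0 y (segCompl u s.val (s.val + 2)) ≠ ringWinU 0 y u ∨
      ringWinU 1 y (segCompl u s.val (s.val + 2)) ≠ ringWinU 1 y u ∨
        ringWinU 2 y (segCompl u s.val (s.val + 2)) ≠ ringWinU 2 y u) := by
  unfold flipAny; rw [mem_filter]; simp only [mem_univ, true_and]

/-- the index set of ALL cells of the swap set: patterns `T ⊆ O` with `T_s ≠ T_t`, form values supported on `G'`. -/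
def idxF (G' : Finset (Fin (n + 1))) (O : Finset (Fin n)) (s t : Fin n) :
    Finset (Finset (Fin n) × (Fin (n + 1) → ZMod p)) :=
  (O.powerset ×ˢ Fintype.piFinset fun g => if g ∈ G' then (univ : Finset (ZMod p)) else {0}).filter fun TV =>
    patt TV.1 s ≠ patt TV.1 t

/-- membership in `idxF`. -/
theorem mem_idxF (G' : Finset (Fin (n + 1))) (O : Finset (Fin n)) (s t : Fin n)
    (TV : Finset (Fin n) × (Fin (n + 1) → ZMod p)) :
    TV ∈ idxF (p := p) G' O s t ↔
      (TV.1 ⊆ O ∧ TV.2 ∈ Fintype.piFinset fun g => if g ∈ G' then (univ : Finset (ZMod p)) else {0}) ∧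
        patt TV.1 s ≠ patt TV.1 t := by
  unfold idxF
  rw [mem_filter, mem_product, mem_powerset]

/-- the size of the index set: `≤ 2^{|O|}·p^{|G'|}`. -/
theorem card_idxF_le (G' : Finset (Fin (n + 1))) (O : Finset (Fin n)) (s t : Fin n) :
    (idxF (p := p) G' O s t).card ≤ 2 ^ O.card * p ^ G'.card := by
  classical
  unfold idxF
  refine (card_filter_le _ _).trans ?_
  rw [card_product, card_powerset, Fintype.card_piFinset]
  have h : ∀ g : Fin (n + 1), (if g ∈ G' then (univ : Finset (ZMod p)) else {0}).card = if g ∈ G' then p else 1 := by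
    intro g
    split_ifs
    · rw [card_univ, ZMod.card]
    · rw [card_singleton]
  rw [prod_congr rfl fun g _ => h g, prod_ite_mem, univ_inter, prod_const]

/-- the first flipping class of a cell (`2` if none of `0, 1` flips). -/
def rflipF (D : JLinData p n) (G' : Finset (Fin (n + 1))) (s t : Fin n) (T : Finset (Fin n)) (V : Fin (n + 1) → ZMod p) : ℕ :=
  if phi D G' s t T V 0 = true then 0 else if phi D G' s t T V 1 = true then 1 else 2

/-- it is an address class. -/
theorem rflipF_lt (D : JLinData p n) (G' : Finset (Fin (n + 1))) (s t : Fin n) (T : Finset (Fin n))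
    (V : Fin (n + 1) → ZMod p) : rflipF D G' s t T V < 3 := by
  unfold rflipF; split_ifs <;> norm_num

/-- a cell FLIPS if its flip table has a flipping class. -/
def flips (D : JLinData p n) (G' : Finset (Fin (n + 1))) (s t : Fin n) (T : Finset (Fin n)) (V : Fin (n + 1) → ZMod p) :
    Bool :=
  (phi D G' s t T V 0 || phi D G' s t T V 1) || phi D G' s t T V 2

/-- on a flipping cell the class `rflipF` flips. -/
theorem phi_rflip (D : JLinData p n) (G' : Finset (Fin (n + 1))) (s t : Fin n) (T : Finset (Fin n))
    (V : Fin (n + 1) → ZMod p) (h : flips D G' s t T V = true) : phi D G' s t T V (rflipF D G' s t T V) = true := by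
  unfold flips at h
  unfold rflipF
  by_cases h0 : phi D G' s t T V 0 = true
  · rw [if_pos h0]; exact h0
  · rw [if_neg h0]
    by_cases h1 : phi D G' s t T V 1 = true
    · rw [if_pos h1]; exact h1
    · rw [if_neg h1]
      rw [Bool.or_eq_true, Bool.or_eq_true] at h
      rcases h with (h | h) | h
      · exact absurd h h0
      · exact absurd h h1
      · exact h

/-- a cell with some flipping class flips. -/
theorem flips_of_phi (D : JLinData p n) (G' : Finset (Fin (n + 1))) (s t : Fin n) (T : Finset (Fin n))
    (V : Fin (n + 1) → ZMod p) (r : ℕ) (hr : r < 3) (h : phi D G' s t T V r = true) : flips D G' s t T V = true := by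
  unfold flips
  rw [Bool.or_eq_true, Bool.or_eq_true]
  interval_cases r
  · exact Or.inl (Or.inl h)
  · exact Or.inl (Or.inr h)
  · exact Or.inr h

/-! ### §12b' cover, class parts, window -/

/-- **(flipAny ⊆ ⋃ flipping cells).** -/
theorem flipAny_subset (D : JLinData p n) (G' : Finset (Fin (n + 1))) (O : Finset (Fin n)) (s t : Fin n)
    (hst : t.val = s.val + 1) (hsO : s ∈ O) (htO : t ∈ O) (htG : cut t ∈ G')
    (hS : ∀ g, g ∉ G' → ∀ u : Fin n → Bool, u s ≠ u t → D.strat g (segCompl u s.val (s.val + 2)) = D.strat g u)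
    (hJO : ∀ g ∈ G', D.J g ⊆ O)
    (hgap : ∀ g ∈ G', ∀ i : Fin n, min g.val t.val ≤ i.val → i.val < max g.val t.val → i ∈ O) :
    flipAny D.strat s t ⊆ ((idxF G' O s t).filter fun TV => flips D G' s t TV.1 TV.2 = true).biUnion fun TV =>
      cellM O (patt TV.1) (formsOf D G') TV.2 := by
  classical
  intro u hu
  rw [mem_flipAny] at hu
  obtain ⟨hne, hflip⟩ := hu
  rw [mem_biUnion]
  have hpat := patt_filter O u
  have hcell : u ∈ cellM O (patt (O.filter fun j => u j = true)) (formsOf D G')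
      (fun g => if g ∈ G' then form (D.a g) u else 0) := by
    rw [mem_cellM]
    refine ⟨hpat, fun g => ?_⟩
    unfold formsOf
    by_cases hg : g ∈ G'
    · rw [if_pos hg, if_pos hg]
    · rw [if_neg hg, if_neg hg, form_zero]
  refine ⟨(O.filter fun j => u j = true, fun g => if g ∈ G' then form (D.a g) u else 0), ?_, hcell⟩
  rw [mem_filter, mem_idxF]
  refine ⟨⟨⟨filter_subset _ _, ?_⟩, ?_⟩, ?_⟩
  · rw [Fintype.mem_piFinset]
    intro g
    by_cases hg : g ∈ G'
    · simp only [if_pos hg]; exact mem_univ _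
    · simp only [if_neg hg]; exact mem_singleton_self _
  · rw [← hpat s hsO, ← hpat t htO]; exact hne
  · have key : ∀ c : ℕ, ringWinU c D.strat (segCompl u s.val (s.val + 2)) ≠ ringWinU c D.strat u →
        flips D G' s t (O.filter fun j => u j = true) (fun g => if g ∈ G' then form (D.a g) u else 0) = true :=
      fun c hc => flips_of_phi D G' s t _ _ (addr c u t.val) (addr_lt_three c u t.val)
        ((flip_iff_phi c D G' O s t hst hsO htO htG hS hJO hgap _ _ u hcell hne).1 hc)
    rcases hflip with h | h | h
    · exact key 0 h
    · exact key 1 h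
    · exact key 2 h

/-- **(the flipping class of a flipping cell lies in `flipE_c`).** -/
theorem classPart_subset_flipE (c : ℕ) (D : JLinData p n) (G' : Finset (Fin (n + 1))) (O : Finset (Fin n)) (s t : Fin n)
    (hst : t.val = s.val + 1) (hsO : s ∈ O) (htO : t ∈ O) (htG : cut t ∈ G')
    (hS : ∀ g, g ∉ G' → ∀ u : Fin n → Bool, u s ≠ u t → D.strat g (segCompl u s.val (s.val + 2)) = D.strat g u)
    (hJO : ∀ g ∈ G', D.J g ⊆ O)
    (hgap : ∀ g ∈ G', ∀ i : Fin n, min g.val t.val ≤ i.val → i.val < max g.val t.val → i ∈ O)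
    (TV : Finset (Fin n) × (Fin (n + 1) → ZMod p)) (hTV : patt TV.1 s ≠ patt TV.1 t)
    (hfl : flips D G' s t TV.1 TV.2 = true) :
    ((cellM O (patt TV.1) (formsOf D G') TV.2).filter fun u => addr c u t.val = rflipF D G' s t TV.1 TV.2)
      ⊆ flipE c D.strat s t := by
  intro u hu
  rw [mem_filter] at hu
  obtain ⟨hcell, hr⟩ := hu
  have hpat := ((mem_cellM O (patt TV.1) (formsOf D G') TV.2 u).1 hcell).1
  have hne : u s ≠ u t := by rw [hpat s hsO, hpat t htO]; exact hTV
  rw [mem_flipE]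
  refine ⟨hne, ?_⟩
  rw [flip_iff_phi c D G' O s t hst hsO htO htG hS hJO hgap _ _ u hcell hne, hr]
  exact phi_rflip D G' s t TV.1 TV.2 hfl

/-- **(counting the flipping classes)** `Σ_{flipping cells} #(class-rflipF part) ≤ |flipE_c|`. -/
theorem sum_classPart_le_flipE (c : ℕ) (D : JLinData p n) (G' : Finset (Fin (n + 1))) (O : Finset (Fin n)) (s t : Fin n)
    (hst : t.val = s.val + 1) (hsO : s ∈ O) (htO : t ∈ O) (htG : cut t ∈ G')
    (hS : ∀ g, g ∉ G' → ∀ u : Fin n → Bool, u s ≠ u t → D.strat g (segCompl u s.val (s.val + 2)) = D.strat g u)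
    (hJO : ∀ g ∈ G', D.J g ⊆ O)
    (hgap : ∀ g ∈ G', ∀ i : Fin n, min g.val t.val ≤ i.val → i.val < max g.val t.val → i ∈ O) :
    ∑ TV ∈ (idxF G' O s t).filter (fun TV => flips D G' s t TV.1 TV.2 = true),
        ((cellM O (patt TV.1) (formsOf D G') TV.2).filter fun u => addr c u t.val = rflipF D G' s t TV.1 TV.2).card
      ≤ (flipE c D.strat s t).card := by
  classical
  rw [← card_biUnion]
  · exact card_le_card (biUnion_subset.2 fun TV hTV =>
      classPart_subset_flipE c D G' O s t hst hsO htO htG hS hJO hgap TV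
        ((mem_idxF G' O s t TV).1 (mem_filter.1 hTV).1).2 (mem_filter.1 hTV).2)
  · intro TV hTV TV' hTV' hne
    have h1 := ((mem_idxF G' O s t TV).1 (mem_filter.1 hTV).1).1.1
    have h2 := ((mem_idxF G' O s t TV').1 (mem_filter.1 hTV').1).1.1
    exact disjoint_filter_filter (cellM_disjoint O (formsOf D G') h1 h2 (by
      intro h; apply hne; exact Prod.ext (congrArg Prod.fst h) (congrArg Prod.snd h)))

omit hp in
/-- the WINDOW of half-width `w` around cut `t`: the positions `i` with `t − w ≤ i < t + w`. -/
def wind (t : Fin n) (w : ℕ) : Finset (Fin n) := univ.filter fun i : Fin n => t.val ≤ i.val + w ∧ i.val < t.val + w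

omit hp in
/-- it has at most `2w` positions. -/
theorem card_wind_le (t : Fin n) (w : ℕ) : (wind t w).card ≤ 2 * w := by
  classical
  have h : (wind t w).card ≤ (range (2 * w)).card := by
    refine card_le_card_of_injOn (fun i : Fin n => i.val + w - t.val) ?_ ?_
    · intro i hi
      simp only [wind, coe_filter, mem_univ, true_and, Set.mem_setOf_eq, coe_range, Set.mem_Iio] at hi ⊢
      omega
    · intro i hi j hj hij
      simp only [wind, coe_filter, mem_univ, true_and, Set.mem_setOf_eq] at hi hj
      simp only at hij
      exact Fin.ext (by omega)
  simpa using h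

/-! ### §12b'' the flip engine -/

/-- ★ **THE FLIP ENGINE INEQUALITY.** for a junta ⊕ `𝔽_p`-form presentation (`3 ∤ p`), an adjacent pair `(s, t = s+1)`,
a half-width `w` and ANY set `G' ∋ cut t` of cuts within distance `w` of cut `t`, outside which the STRATEGY is swap-stable on the
swap set: `6·#WIN_c + #flipAny ≤ 6·2ⁿ + 8·p^{|G'|}·2^{Σ_{g ∈ G'} |J_g| + 2w}·(2cos(π/(3p)))ⁿ`.  The readers may react. -/
theorem engineFlip (hp3 : p ≠ 3) (c : ℕ) (D : JLinData p n) (s t : Fin n) (hst : t.val = s.val + 1)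
    (G' : Finset (Fin (n + 1))) (htG : cut t ∈ G') (w : ℕ) (hnear : ∀ g ∈ G', t.val ≤ g.val + w ∧ g.val ≤ t.val + w)
    (hS : ∀ g, g ∉ G' → ∀ u : Fin n → Bool, u s ≠ u t → D.strat g (segCompl u s.val (s.val + 2)) = D.strat g u) :
    6 * ((univ.filter fun u : Fin n → Bool => ringWinU c D.strat u = true).card : ℝ)
      + ((flipAny D.strat s t).card : ℝ)
      ≤ 6 * (2 : ℝ) ^ n + 8 * (p : ℝ) ^ G'.card *
          (2 : ℝ) ^ ((∑ g ∈ G', (D.J g).card) + 2 * w) * (2 * Real.cos (Real.pi / (3 * p))) ^ n := by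
  classical
  set O : Finset (Fin n) := insert s (insert t (G'.biUnion D.J ∪ wind t w)) with hO
  have hJO : ∀ g ∈ G', D.J g ⊆ O := fun g hg i hi => by
    rw [hO]; exact mem_insert_of_mem (mem_insert_of_mem (mem_union_left _ (mem_biUnion.2 ⟨g, hg, hi⟩)))
  have hsO : s ∈ O := by rw [hO]; exact mem_insert_self _ _
  have htO : t ∈ O := by rw [hO]; exact mem_insert_of_mem (mem_insert_self _ _)
  have hgap : ∀ g ∈ G', ∀ i : Fin n, min g.val t.val ≤ i.val → i.val < max g.val t.val → i ∈ O := by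
    intro g hg i h1 h2
    have hn := hnear g hg
    rw [min_le_iff] at h1
    rw [lt_max_iff] at h2
    rw [hO]
    refine mem_insert_of_mem (mem_insert_of_mem (mem_union_right _ ?_))
    unfold wind
    rw [mem_filter]
    exact ⟨mem_univ _, by omega, by omega⟩
  have hOcard : O.card ≤ (∑ g ∈ G', (D.J g).card) + 2 * w + 2 := by
    rw [hO]
    refine (card_insert_le _ _).trans ?_
    have h1 := card_insert_le t (G'.biUnion D.J ∪ wind t w)
    have h2 : (G'.biUnion D.J).card ≤ ∑ g ∈ G', (D.J g).card := card_biUnion_le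
    have h3 := card_union_le (G'.biUnion D.J) (wind t w)
    have h4 := card_wind_le t w
    omega
  set err : ℝ := 2 * (2 * Real.cos (Real.pi / (3 * p))) ^ n with herr
  -- (1) the pairing inequality
  have hpair := flip_pairing c D.strat s t hst
  -- (2) flipAny is covered by the flipping cells
  have hR : ((flipAny D.strat s t).card : ℝ)
      ≤ ∑ TV ∈ (idxF G' O s t).filter (fun TV => flips D G' s t TV.1 TV.2 = true),
          ((cellM O (patt TV.1) (formsOf D G') TV.2).card : ℝ) := by
    have h := (card_le_card (flipAny_subset D G' O s t hst hsO htO htG hS hJO hgap)).trans card_biUnion_le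
    exact_mod_cast h
  -- (3) the flipping classes fit into flipE
  have hE := sum_classPart_le_flipE c D G' O s t hst hsO htO htG hS hJO hgap
  -- (4) per flipping cell: a third, up to err
  have hcell : ∀ TV ∈ (idxF G' O s t).filter (fun TV => flips D G' s t TV.1 TV.2 = true),
      ((cellM O (patt TV.1) (formsOf D G') TV.2).card : ℝ) ≤
        3 * ((((cellM O (patt TV.1) (formsOf D G') TV.2).filter fun u =>
            addr c u t.val = rflipF D G' s t TV.1 TV.2).card : ℕ) : ℝ) + err := by
    intro TV _
    exact cell_le_three_addrM hp3 c O (patt TV.1) (formsOf D G') TV.2 t _ (rflipF_lt D G' s t TV.1 TV.2)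
  have hsum := sum_le_sum hcell
  rw [sum_add_distrib, ← mul_sum, sum_const, nsmul_eq_mul] at hsum
  -- (5) sizes
  have hidx : (((idxF G' O s t).filter (fun TV => flips D G' s t TV.1 TV.2 = true)).card : ℝ)
      ≤ 4 * (2 : ℝ) ^ ((∑ g ∈ G', (D.J g).card) + 2 * w) * (p : ℝ) ^ G'.card := by
    have h := (card_filter_le (idxF G' O s t) (fun TV => flips D G' s t TV.1 TV.2 = true)).trans
      (card_idxF_le (p := p) G' O s t)
    have h2 : (2 : ℕ) ^ O.card ≤ 2 ^ ((∑ g ∈ G', (D.J g).card) + 2 * w + 2) := Nat.pow_le_pow_right (by norm_num) hOcard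
    have h3 : ((idxF G' O s t).filter (fun TV => flips D G' s t TV.1 TV.2 = true)).card
        ≤ 2 ^ ((∑ g ∈ G', (D.J g).card) + 2 * w + 2) * p ^ G'.card := h.trans (Nat.mul_le_mul_right _ h2)
    have h4 : (((idxF G' O s t).filter (fun TV => flips D G' s t TV.1 TV.2 = true)).card : ℝ)
        ≤ ((2 ^ ((∑ g ∈ G', (D.J g).card) + 2 * w + 2) * p ^ G'.card : ℕ) : ℝ) := by exact_mod_cast h3
    refine h4.trans (le_of_eq ?_)
    push_cast
    ring
  have herr0 : 0 ≤ err := by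
    rw [herr]
    have hcos : 0 ≤ Real.cos (Real.pi / (3 * p)) := by
      apply Real.cos_nonneg_of_neg_pi_div_two_le_of_le
      · have : 0 ≤ Real.pi / (3 * p) := by positivity
        linarith [Real.pi_pos]
      · rw [div_le_div_iff₀ (by have := hp.out.pos; positivity) (by norm_num)]
        have : (2 : ℝ) ≤ p := by exact_mod_cast hp.out.two_le
        nlinarith [Real.pi_pos]
    positivity
  have hpairR : 2 * ((univ.filter fun u : Fin n → Bool => ringWinU c D.strat u = true).card : ℝ)
      + ((flipE c D.strat s t).card : ℝ) ≤ 2 * (2 : ℝ) ^ n := by exact_mod_cast hpair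
  have hER : ((∑ TV ∈ (idxF G' O s t).filter (fun TV => flips D G' s t TV.1 TV.2 = true),
      ((cellM O (patt TV.1) (formsOf D G') TV.2).filter fun u =>
          addr c u t.val = rflipF D G' s t TV.1 TV.2).card : ℕ) : ℝ)
      ≤ ((flipE c D.strat s t).card : ℝ) := by exact_mod_cast hE
  push_cast at hER hsum
  have hpp : (0 : ℝ) ≤ 4 * (2 : ℝ) ^ ((∑ g ∈ G', (D.J g).card) + 2 * w) * (p : ℝ) ^ G'.card := by positivity
  have hmul : (((idxF G' O s t).filter (fun TV => flips D G' s t TV.1 TV.2 = true)).card : ℝ) * err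
      ≤ 4 * (2 : ℝ) ^ ((∑ g ∈ G', (D.J g).card) + 2 * w) * (p : ℝ) ^ G'.card * err :=
    mul_le_mul_of_nonneg_right hidx herr0
  rw [herr] at hmul
  nlinarith [hR, hsum, hER, hpairR, hmul, herr0]

end FlipEngine

end Summit.QuantumAdvantage.AdviceFreeQNC0.JLinPeel.TokenDial
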